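import Literature.AlgebraicGeometry.Frobenioids.ModelFrobenioidPreSteps
import HarnessLib

/-!
# Frobenioids I, Theorem 5.2 (ii) for the model Frobenioid: isomorphisms with UNIT zero divisor and the
# descent of an automorphism along a base-isomorphism — WITHOUT `Φ` divisorial

Mochizuki, *The geometry of Frobenioids I: the general theory*, Kyushu J. Math. **62** (2008), §5,
Theorem 5.2 (i)–(ii), kurims text pp. 100–101 [cite: MochizukiFrdI2008, Thm. 5.2(ii) p.101]; the property
established is the one of Definition 1.3 (iii)(d) ("the first equivalence of categories involving pre-steps")
specialised to the EXPLICIT category `C = ModelFrobenioid Φ B DivB` of Thm. 5.2 (i) (a morphism is the data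
`(deg_Fr, Base, Div, u)` subject to relation (d)), under the hypothesis `B` group-like ONLY.

The landed file `ModelFrobenioidPreSteps.lean` (abc-iut-L6-t12) works under BOTH hypotheses of Thm. 5.2
(`Φ` divisorial, `B` group-like): there an isomorphism has zero divisor `0` (`Φ` sharp).  Over a divisor
monoid that is not sharp, the zero divisor of an isomorphism is merely a UNIT of `Φ(A_D)` (Remark 1.1.1),
and the two facts below are what survives — they are exactly what the proof of [EtTh] Prop. 4.3 (i) (p.91)
uses (abc-iut cell, block F, seat abc-iut-f-109, FACT-LIST row F-0492):
* `isIso_of_isUnit_div` — a morphism `(1, f, d, u)` with `f` an isomorphism of `D` and `d ∈ Φ(A_D)^×` is an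
  isomorphism (inverse `(1, f⁻¹, (f⁻¹)^* d⁻¹, (f⁻¹)^* u⁻¹)`);
* `exists_aut_comp_eq_of_pull_div_eq` — for a LINEAR `s : X → Y` with `Base(s)` an isomorphism and
  `τ ∈ Aut_C(X)` FIXING `Div(s)`, there is `σ ∈ Aut_C(Y)` with `σ ∘ s = s ∘ τ`, namely
  `σ := (1, b⁻¹ ∘ Base(τ) ∘ b, (b⁻¹)^* Div(τ), (b⁻¹)^*(Base(τ)^* u_s · u_τ · u_s⁻¹))`, `b := Base(s)`.
Diagrammatic composition (`φ ≫ ψ` = the paper's `ψ ∘ φ`); monoids written multiplicatively.  No definitions.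
-/

noncomputable section

namespace Literature.AlgebraicGeometry.Frobenioids

namespace ModelFrobenioid

open CategoryTheory Opposite
open PreFrobenioid (pull_inv_pull_eq pull_pull_inv_eq pull_injective pullGp_of' pullGp_inv_pullGp
  pullGp_pullGp_inv pullGp_injective)

universe w v u

variable {D : Type u} [Category.{v} D] {Φ B : Dᵒᵖ ⥤ CommMonCat.{w}} {DivB : B ⟶ monoidGp Φ}
  {X Y : ModelFrobenioid Φ B DivB}

/-! ### Isomorphisms with unit zero divisor -/

/-- **A morphism `(1, f, d, u)` of the model Frobenioid with `f` an isomorphism of `D` and `d` a UNIT of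
`Φ(A_D)` is an isomorphism** (inverse `(1, f⁻¹, (f⁻¹)^* d⁻¹, (f⁻¹)^* u⁻¹)`; `B` group-like) — the landed
`isIso_of` without the sharpness assumption `d = 0`. [cite: MochizukiFrdI2008, Thm. 5.2(ii) p.101] -/
theorem isIso_of_isUnit_div (hBg : Objectwise (fun M _ => IsGroupLike M) B) (φ : X ⟶ Y)
    [IsIso (baseMap φ)] (hd : IsUnit (div φ)) (hn : degFr φ = 1) : IsIso φ := by
  obtain ⟨uu, huu⟩ := (hBg X.base).isUnit (unit φ)
  obtain ⟨dd, hdd⟩ := hd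
  -- relation (d) of `φ`, transported along `Base(φ)⁻¹`
  have hφ : X.cls * Algebra.GrothendieckGroup.of (div φ) =
      pullGp Φ (baseMap φ) Y.cls * divB Φ B DivB _ (unit φ) := by
    have h := rel φ
    rwa [hn, PNat.one_coe, pow_one] at h
  have hY : pullGp Φ (inv (baseMap φ)) X.cls *
      Algebra.GrothendieckGroup.of (pull Φ (inv (baseMap φ)) (div φ)) =
        Y.cls * divB Φ B DivB _ (pull B (inv (baseMap φ)) (unit φ)) := by
    have h := congrArg (pullGp Φ (inv (baseMap φ))) hφ
    rwa [map_mul, map_mul, pullGp_inv_pullGp, pullGp_of', pullGp_divB_pull] at h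
  have hdinv : Algebra.GrothendieckGroup.of (pull Φ (inv (baseMap φ)) (↑dd⁻¹ : Φ.obj (op X.base))) =
      (Algebra.GrothendieckGroup.of (pull Φ (inv (baseMap φ)) (div φ)))⁻¹ := by
    apply eq_inv_of_mul_eq_one_left
    rw [← map_mul, ← map_mul, ← hdd, Units.inv_mul, map_one, map_one]
  have huinv : divB Φ B DivB (op Y.base) (pull B (inv (baseMap φ)) (↑uu⁻¹ : B.obj (op X.base))) =
      (divB Φ B DivB (op Y.base) (pull B (inv (baseMap φ)) (unit φ)))⁻¹ := by
    apply eq_inv_of_mul_eq_one_left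
    rw [← map_mul, ← map_mul, ← huu, Units.inv_mul, map_one, map_one]
  refine ⟨⟨mkHom Y X 1 (inv (baseMap φ)) (pull Φ (inv (baseMap φ)) ↑dd⁻¹)
    (pull B (inv (baseMap φ)) ↑uu⁻¹) ?_, ?_, ?_⟩⟩
  · rw [PNat.one_coe, pow_one, hdinv, huinv, mul_inv_eq_iff_eq_mul, mul_right_comm, eq_mul_inv_iff_mul_eq]
    exact hY.symm
  · refine hom_ext ?_ (IsIso.hom_inv_id _) ?_ ?_
    · show (1 : ℕ+) * degFr φ = 1
      rw [hn, mul_one]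
    · show pull Φ (baseMap φ) (pull Φ (inv (baseMap φ)) ↑dd⁻¹) * div φ ^ ((1 : ℕ+) : ℕ) = 1
      rw [pull_pull_inv_eq, PNat.one_coe, pow_one, ← hdd, Units.inv_mul]
    · show pull B (baseMap φ) (pull B (inv (baseMap φ)) ↑uu⁻¹) * unit φ ^ ((1 : ℕ+) : ℕ) = 1
      rw [pull_pull_inv_eq, PNat.one_coe, pow_one, ← huu, Units.inv_mul]
  · refine hom_ext ?_ (IsIso.inv_hom_id _) ?_ ?_
    · show degFr φ * 1 = 1
      rw [hn, mul_one]
    · show pull Φ (inv (baseMap φ)) (div φ) * (pull Φ (inv (baseMap φ)) ↑dd⁻¹) ^ (degFr φ : ℕ) = 1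
      rw [hn, PNat.one_coe, pow_one, ← map_mul, ← hdd, Units.mul_inv, map_one]
    · show pull B (inv (baseMap φ)) (unit φ) * (pull B (inv (baseMap φ)) ↑uu⁻¹) ^ (degFr φ : ℕ) = 1
      rw [hn, PNat.one_coe, pow_one, ← map_mul, ← huu, Units.mul_inv, map_one]

/-! ### Descent of an automorphism along a linear base-isomorphism ([FrdI] Def. 1.3 (iii)(d) for the model) -/

/-- The commutative-group bookkeeping behind `exists_aut_comp_eq_of_pull_div_eq`. [folklore] -/
private theorem descent_rel_aux {G : Type w} [CommGroup G] (Xc Ds Dτ Es Eτ Ets : G) :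
    Xc * Ds * Es⁻¹ * Dτ = Xc * Dτ * Eτ⁻¹ * Ds * Ets⁻¹ * (Ets * Eτ * Es⁻¹) := by
  apply Additive.ofMul.injective
  simp only [ofMul_mul, ofMul_inv]
  abel

/-- **Descent of an automorphism along a base-isomorphism, in the model Frobenioid** ("the first
equivalence of categories involving pre-steps of [FrdI] Def. 1.3 (iii)(d)", in the form used by the proof
of [EtTh] Prop. 4.3 (i), p.91): for a LINEAR `s : X → Y` with `Base(s)` an isomorphism and `τ ∈ Aut_C(X)`
FIXING `Div(s)` (`Base(τ)^* Div(s) = Div(s)`), there is `σ ∈ Aut_C(Y)` with `σ ∘ s = s ∘ τ` — namely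
`σ := (1, b⁻¹ ∘ Base(τ) ∘ b, (b⁻¹)^* Div(τ), (b⁻¹)^*(Base(τ)^* u_s · u_τ · u_s⁻¹))`, `b := Base(s)`; here
`Div(τ)` is a unit of `Φ(A_D)`, not assumed trivial (`B` group-like; NO divisoriality of `Φ`).
[cite: MochizukiFrdI2008, Thm. 5.2(ii) p.101] -/
theorem exists_aut_comp_eq_of_pull_div_eq (hBg : Objectwise (fun M _ => IsGroupLike M) B)
    (s : X ⟶ Y) [IsIso (baseMap s)] (hs : degFr s = 1) (τ : Aut X)
    (hτ : pull Φ (baseMap τ.hom) (div s) = div s) :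
    ∃ σ : Aut Y, s ≫ σ.hom = τ.hom ≫ s := by
  haveI : IsIso (baseMap τ.hom) := isIso_baseMap_of_isIso τ.hom
  have hτ1 : degFr τ.hom = 1 := degFr_eq_one_of_isIso τ.hom
  obtain ⟨us, hus⟩ := (hBg X.base).isUnit (unit s)
  -- the relations (d) of `s` and of `τ`
  have hrs : pullGp Φ (baseMap s) Y.cls = X.cls * Algebra.GrothendieckGroup.of (div s) *
      (divB Φ B DivB _ (unit s))⁻¹ := by
    have h := rel s
    rw [hs, PNat.one_coe, pow_one] at h
    exact eq_mul_inv_of_mul_eq h.symm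
  have hrτ : pullGp Φ (baseMap τ.hom) X.cls = X.cls * Algebra.GrothendieckGroup.of (div τ.hom) *
      (divB Φ B DivB _ (unit τ.hom))⁻¹ := by
    have h := rel τ.hom
    rw [hτ1, PNat.one_coe, pow_one] at h
    exact eq_mul_inv_of_mul_eq h.symm
  have husinv : divB Φ B DivB (op X.base) (↑us⁻¹ : B.obj (op X.base)) =
      (divB Φ B DivB (op X.base) (unit s))⁻¹ := by
    apply eq_inv_of_mul_eq_one_left
    rw [← map_mul, ← hus, Units.inv_mul, map_one]
  -- relation (d) for the candidate `σ`
  have hrel : Y.cls ^ ((1 : ℕ+) : ℕ) *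
      Algebra.GrothendieckGroup.of (pull Φ (inv (baseMap s)) (div τ.hom)) =
        pullGp Φ (inv (baseMap s) ≫ baseMap τ.hom ≫ baseMap s) Y.cls *
          divB Φ B DivB (op Y.base) (pull B (inv (baseMap s))
            (pull B (baseMap τ.hom) (unit s) * unit τ.hom * ↑us⁻¹)) := by
    apply pullGp_injective (baseMap s)
    have hL : pullGp Φ (baseMap s) (Y.cls ^ ((1 : ℕ+) : ℕ) *
        Algebra.GrothendieckGroup.of (pull Φ (inv (baseMap s)) (div τ.hom))) =
          pullGp Φ (baseMap s) Y.cls * Algebra.GrothendieckGroup.of (div τ.hom) := by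
      rw [PNat.one_coe, pow_one, map_mul, pullGp_of', pull_pull_inv_eq]
    have hR : pullGp Φ (baseMap s) (pullGp Φ (inv (baseMap s) ≫ baseMap τ.hom ≫ baseMap s) Y.cls *
        divB Φ B DivB (op Y.base) (pull B (inv (baseMap s))
          (pull B (baseMap τ.hom) (unit s) * unit τ.hom * ↑us⁻¹))) =
        pullGp Φ (baseMap τ.hom) (pullGp Φ (baseMap s) Y.cls) *
          (divB Φ B DivB _ (pull B (baseMap τ.hom) (unit s)) * divB Φ B DivB _ (unit τ.hom) *
            divB Φ B DivB (op X.base) (↑us⁻¹ : B.obj (op X.base))) := by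
      rw [map_mul, ← pullGp_comp, IsIso.hom_inv_id_assoc, pullGp_comp, pullGp_divB_pull,
        pull_pull_inv_eq, map_mul, map_mul]
    have hT : pullGp Φ (baseMap τ.hom) (pullGp Φ (baseMap s) Y.cls) =
        X.cls * Algebra.GrothendieckGroup.of (div τ.hom) * (divB Φ B DivB _ (unit τ.hom))⁻¹ *
          Algebra.GrothendieckGroup.of (div s) *
            (divB Φ B DivB _ (pull B (baseMap τ.hom) (unit s)))⁻¹ := by
      rw [hrs, map_mul, map_mul, map_inv, hrτ, pullGp_of', hτ, pullGp_divB_pull]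
    rw [hL, hR, hT, hrs, husinv]
    exact descent_rel_aux _ _ _ _ _ _
  -- the candidate and its properties
  let σ₀ : Y ⟶ Y := mkHom Y Y 1 (inv (baseMap s) ≫ baseMap τ.hom ≫ baseMap s)
    (pull Φ (inv (baseMap s)) (div τ.hom))
    (pull B (inv (baseMap s)) (pull B (baseMap τ.hom) (unit s) * unit τ.hom * ↑us⁻¹)) hrel
  haveI : IsIso (baseMap σ₀) := by
    change IsIso (inv (baseMap s) ≫ baseMap τ.hom ≫ baseMap s)
    infer_instance
  have hunit : IsUnit (div σ₀) :=
    (ElemFrobenioid.isUnit_div_of_isIso ((toElem Φ B DivB).map τ.hom)).map (pull Φ (inv (baseMap s)))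
  haveI : IsIso σ₀ := isIso_of_isUnit_div hBg σ₀ hunit rfl
  refine ⟨asIso σ₀, hom_ext ?_ ?_ ?_ ?_⟩
  · show (1 : ℕ+) * degFr s = degFr s * degFr τ.hom
    rw [hτ1, one_mul, mul_one]
  · show baseMap s ≫ (inv (baseMap s) ≫ baseMap τ.hom ≫ baseMap s) = baseMap τ.hom ≫ baseMap s
    rw [IsIso.hom_inv_id_assoc]
  · show pull Φ (baseMap s) (pull Φ (inv (baseMap s)) (div τ.hom)) * div s ^ ((1 : ℕ+) : ℕ) =
      pull Φ (baseMap τ.hom) (div s) * div τ.hom ^ (degFr s : ℕ)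
    rw [pull_pull_inv_eq, hs, PNat.one_coe, pow_one, pow_one, hτ, mul_comm]
  · show pull B (baseMap s) (pull B (inv (baseMap s))
        (pull B (baseMap τ.hom) (unit s) * unit τ.hom * ↑us⁻¹)) * unit s ^ ((1 : ℕ+) : ℕ) =
      pull B (baseMap τ.hom) (unit s) * unit τ.hom ^ (degFr s : ℕ)
    rw [pull_pull_inv_eq, hs, PNat.one_coe, pow_one, pow_one, ← hus, Units.inv_mul_cancel_right]

/-- **Descent of an automorphism along a PRE-STEP** ([FrdI] Def. 1.2 (iii): linear base-isomorphism) fixing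
its zero divisor. [cite: MochizukiFrdI2008, Thm. 5.2(ii) p.101] -/
theorem exists_aut_comp_eq_of_isPreStep_of_pull_div_eq (hBg : Objectwise (fun M _ => IsGroupLike M) B)
    {s : X ⟶ Y} (hs : PreFrobenioid.IsPreStep (toElem Φ B DivB) s) (τ : Aut X)
    (hτ : pull Φ (baseMap τ.hom) (div s) = div s) :
    ∃ σ : Aut Y, s ≫ σ.hom = τ.hom ≫ s :=
  haveI : IsIso (baseMap s) := hs.2
  exists_aut_comp_eq_of_pull_div_eq hBg s hs.1 τ hτ

end ModelFrobenioid

end Literature.AlgebraicGeometry.Frobenioids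

end
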